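import Mathlib.Tactic.Ring
import Mathlib.Tactic.LinearCombination
import Mathlib.Data.Real.Basic
import HarnessLib

/-!
# Conjecture N (hodge-weil ladder, GAPS G51b), format (4,2): the F-DELETION IDENTITY

Prover 2, generation 11 (note `run/shared/lean/b2b/hodge-weil/b2b-hweil-pv2-g11/CROSS-MAX-G11.md`, ADDENDUM 1). Setting of
`b2b-hweil-pv2-g9/CONJECTURE-N.md` §1, format (4,2), centred variables; `Q₂ = ½(ΣεA²)(Σεu²) + (ΣεAu)² − 3ΣεA²u²`,
`Q₄ = 3Σεu⁴ − (3/2)(Σεu²)²`, `G₀ = Q₂ + Q₄`, purity residuals `P1 = ΣεA²u`, `P2 = ΣεAu²`, `P4 = Σεu³`.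
THE IDENTITY. Single out an F-root, at centred position `a` with charge `c`. The other five roots `D = {E₁,…,E₄, F'}` have signed mass
`3`, so by the centring of the whole configuration their positions are `a/3 + y_k` and their charges `c/3 + ζ_k` with `Σ_Dεy = Σ_Dεζ = 0`
(`y`, `ζ` = coordinates of `D` centred at ITS OWN signed means). Then, as polynomial identities,
`Q₂ = Q₂(D) − 2a·P2 − 2c·P1` and `Q₄ = Q₄(D) + 4c·P4`, where `Q₂(D) = ½S_yS_ζ + S_{yζ}² − 3S_{y²ζ²}`, `Q₄(D) = 3S_{ζ⁴} − (3/2)S_ζ²` are the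
SAME functionals evaluated on the five-root configuration `D` (signed sums over `D`). CONSEQUENCE: on PURE configurations `Q₂`, `Q₄` and
`G₀` are unchanged when an F-root is deleted and the rest is re-centred: `G₀(Γ) = G₀(Γ ∖ F_j)` — Conjecture N in format (4,2) is a statement
about the (4,1) configurations that can be completed to a pure ample (4,2) configuration by one F-root. (The cancellation is special to
signed mass 2 = virtual rank 2: deleting a root of sign ε from a configuration whose rest has mass m is correction-free iff εm² + m + 6 = 0,
i.e. ε = −1, m = 3.) Companion of `WeilClassTestEscapeDirections.lean` (E-root deletion = the cluster form, NOT correction-free). Pure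
algebra (`ring`, `linear_combination`); nothing here is a rung, a door edge or a cited fact; no statement of Markman's papers is used.
-/

set_option linter.dupNamespace false

namespace Summit.HodgeConjecture.HodgeConjecture.WeilClassTestFDeletion

/-- F-DELETION IDENTITY (format (4,2)). Deleted F-root at `(a, c)`; the five others at positions `a/3 + y_k`, charges `c/3 + ζ_k`
(`k = 1..4` the E-roots, `k = 5` the remaining F-root, with `y₅ = y₁+y₂+y₃+y₄`, `ζ₅ = ζ₁+ζ₂+ζ₃+ζ₄` = the two centrings of `D`).
Conjunct 1: `Q₂(Γ) = Q₂(D) − 2a·P2(Γ) − 2c·P1(Γ)`; conjunct 2: `Q₄(Γ) = Q₄(D) + 4c·P4(Γ)`. -/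
theorem fDeletion_identities (a c y₁ y₂ y₃ y₄ ζ₁ ζ₂ ζ₃ ζ₄ : ℝ) :
    let y₅ : ℝ := y₁ + y₂ + y₃ + y₄
    let ζ₅ : ℝ := ζ₁ + ζ₂ + ζ₃ + ζ₄
    -- the full configuration Γ (E-roots 1..4, F-roots: 5 and the deleted one)
    let A₁ : ℝ := a / 3 + y₁
    let A₂ : ℝ := a / 3 + y₂
    let A₃ : ℝ := a / 3 + y₃
    let A₄ : ℝ := a / 3 + y₄
    let B₁ : ℝ := a / 3 + y₅
    let B₂ : ℝ := a
    let u₁ : ℝ := c / 3 + ζ₁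
    let u₂ : ℝ := c / 3 + ζ₂
    let u₃ : ℝ := c / 3 + ζ₃
    let u₄ : ℝ := c / 3 + ζ₄
    let v₁ : ℝ := c / 3 + ζ₅
    let v₂ : ℝ := c
    let SA : ℝ := A₁ ^ 2 + A₂ ^ 2 + A₃ ^ 2 + A₄ ^ 2 - (B₁ ^ 2 + B₂ ^ 2)
    let Su : ℝ := u₁ ^ 2 + u₂ ^ 2 + u₃ ^ 2 + u₄ ^ 2 - (v₁ ^ 2 + v₂ ^ 2)
    let SAu : ℝ := A₁ * u₁ + A₂ * u₂ + A₃ * u₃ + A₄ * u₄ - (B₁ * v₁ + B₂ * v₂)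
    let SA2u2 : ℝ := A₁ ^ 2 * u₁ ^ 2 + A₂ ^ 2 * u₂ ^ 2 + A₃ ^ 2 * u₃ ^ 2 + A₄ ^ 2 * u₄ ^ 2
      - (B₁ ^ 2 * v₁ ^ 2 + B₂ ^ 2 * v₂ ^ 2)
    let Su4 : ℝ := u₁ ^ 4 + u₂ ^ 4 + u₃ ^ 4 + u₄ ^ 4 - (v₁ ^ 4 + v₂ ^ 4)
    let P1 : ℝ := A₁ ^ 2 * u₁ + A₂ ^ 2 * u₂ + A₃ ^ 2 * u₃ + A₄ ^ 2 * u₄ - (B₁ ^ 2 * v₁ + B₂ ^ 2 * v₂)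
    let P2 : ℝ := A₁ * u₁ ^ 2 + A₂ * u₂ ^ 2 + A₃ * u₃ ^ 2 + A₄ * u₄ ^ 2 - (B₁ * v₁ ^ 2 + B₂ * v₂ ^ 2)
    let P4 : ℝ := u₁ ^ 3 + u₂ ^ 3 + u₃ ^ 3 + u₄ ^ 3 - (v₁ ^ 3 + v₂ ^ 3)
    -- the five-root configuration D in its own centred coordinates
    let Sy : ℝ := y₁ ^ 2 + y₂ ^ 2 + y₃ ^ 2 + y₄ ^ 2 - y₅ ^ 2
    let Sz : ℝ := ζ₁ ^ 2 + ζ₂ ^ 2 + ζ₃ ^ 2 + ζ₄ ^ 2 - ζ₅ ^ 2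
    let Syz : ℝ := y₁ * ζ₁ + y₂ * ζ₂ + y₃ * ζ₃ + y₄ * ζ₄ - y₅ * ζ₅
    let Sy2z2 : ℝ := y₁ ^ 2 * ζ₁ ^ 2 + y₂ ^ 2 * ζ₂ ^ 2 + y₃ ^ 2 * ζ₃ ^ 2 + y₄ ^ 2 * ζ₄ ^ 2 - y₅ ^ 2 * ζ₅ ^ 2
    let Sz4 : ℝ := ζ₁ ^ 4 + ζ₂ ^ 4 + ζ₃ ^ 4 + ζ₄ ^ 4 - ζ₅ ^ 4
    (1 / 2 * SA * Su + SAu ^ 2 - 3 * SA2u2 = (1 / 2 * Sy * Sz + Syz ^ 2 - 3 * Sy2z2) - 2 * a * P2 - 2 * c * P1)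
    ∧ (3 * Su4 - 3 / 2 * Su ^ 2 = (3 * Sz4 - 3 / 2 * Sz ^ 2) + 4 * c * P4) := by
  intro y₅ ζ₅ A₁ A₂ A₃ A₄ B₁ B₂ u₁ u₂ u₃ u₄ v₁ v₂ SA Su SAu SA2u2 Su4 P1 P2 P4 Sy Sz Syz Sy2z2 Sz4
  refine ⟨?_, ?_⟩
  · simp only [SA, Su, SAu, SA2u2, P1, P2, Sy, Sz, Syz, Sy2z2, A₁, A₂, A₃, A₄, B₁, B₂, u₁, u₂, u₃, u₄, v₁, v₂, y₅, ζ₅]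
    ring
  · simp only [Su4, Su, P4, Sz4, Sz, u₁, u₂, u₃, u₄, v₁, v₂, ζ₅]
    ring

/-- Corollary (F-DELETION INVARIANCE on pure configurations): if `P1 = P2 = P4 = 0` then `G₀(Γ) = G₀(D)`. -/
theorem fDeletion_pure (a c y₁ y₂ y₃ y₄ ζ₁ ζ₂ ζ₃ ζ₄ : ℝ)
    (hP1 : (a / 3 + y₁) ^ 2 * (c / 3 + ζ₁) + (a / 3 + y₂) ^ 2 * (c / 3 + ζ₂) + (a / 3 + y₃) ^ 2 * (c / 3 + ζ₃)
        + (a / 3 + y₄) ^ 2 * (c / 3 + ζ₄)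
        - ((a / 3 + (y₁ + y₂ + y₃ + y₄)) ^ 2 * (c / 3 + (ζ₁ + ζ₂ + ζ₃ + ζ₄)) + a ^ 2 * c) = 0)
    (hP2 : (a / 3 + y₁) * (c / 3 + ζ₁) ^ 2 + (a / 3 + y₂) * (c / 3 + ζ₂) ^ 2 + (a / 3 + y₃) * (c / 3 + ζ₃) ^ 2
        + (a / 3 + y₄) * (c / 3 + ζ₄) ^ 2
        - ((a / 3 + (y₁ + y₂ + y₃ + y₄)) * (c / 3 + (ζ₁ + ζ₂ + ζ₃ + ζ₄)) ^ 2 + a * c ^ 2) = 0)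
    (hP4 : (c / 3 + ζ₁) ^ 3 + (c / 3 + ζ₂) ^ 3 + (c / 3 + ζ₃) ^ 3 + (c / 3 + ζ₄) ^ 3
        - ((c / 3 + (ζ₁ + ζ₂ + ζ₃ + ζ₄)) ^ 3 + c ^ 3) = 0) :
    let y₅ : ℝ := y₁ + y₂ + y₃ + y₄
    let ζ₅ : ℝ := ζ₁ + ζ₂ + ζ₃ + ζ₄
    let A₁ : ℝ := a / 3 + y₁
    let A₂ : ℝ := a / 3 + y₂
    let A₃ : ℝ := a / 3 + y₃
    let A₄ : ℝ := a / 3 + y₄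
    let B₁ : ℝ := a / 3 + y₅
    let B₂ : ℝ := a
    let u₁ : ℝ := c / 3 + ζ₁
    let u₂ : ℝ := c / 3 + ζ₂
    let u₃ : ℝ := c / 3 + ζ₃
    let u₄ : ℝ := c / 3 + ζ₄
    let v₁ : ℝ := c / 3 + ζ₅
    let v₂ : ℝ := c
    let SA : ℝ := A₁ ^ 2 + A₂ ^ 2 + A₃ ^ 2 + A₄ ^ 2 - (B₁ ^ 2 + B₂ ^ 2)
    let Su : ℝ := u₁ ^ 2 + u₂ ^ 2 + u₃ ^ 2 + u₄ ^ 2 - (v₁ ^ 2 + v₂ ^ 2)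
    let SAu : ℝ := A₁ * u₁ + A₂ * u₂ + A₃ * u₃ + A₄ * u₄ - (B₁ * v₁ + B₂ * v₂)
    let SA2u2 : ℝ := A₁ ^ 2 * u₁ ^ 2 + A₂ ^ 2 * u₂ ^ 2 + A₃ ^ 2 * u₃ ^ 2 + A₄ ^ 2 * u₄ ^ 2
      - (B₁ ^ 2 * v₁ ^ 2 + B₂ ^ 2 * v₂ ^ 2)
    let Su4 : ℝ := u₁ ^ 4 + u₂ ^ 4 + u₃ ^ 4 + u₄ ^ 4 - (v₁ ^ 4 + v₂ ^ 4)
    let Sy : ℝ := y₁ ^ 2 + y₂ ^ 2 + y₃ ^ 2 + y₄ ^ 2 - y₅ ^ 2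
    let Sz : ℝ := ζ₁ ^ 2 + ζ₂ ^ 2 + ζ₃ ^ 2 + ζ₄ ^ 2 - ζ₅ ^ 2
    let Syz : ℝ := y₁ * ζ₁ + y₂ * ζ₂ + y₃ * ζ₃ + y₄ * ζ₄ - y₅ * ζ₅
    let Sy2z2 : ℝ := y₁ ^ 2 * ζ₁ ^ 2 + y₂ ^ 2 * ζ₂ ^ 2 + y₃ ^ 2 * ζ₃ ^ 2 + y₄ ^ 2 * ζ₄ ^ 2 - y₅ ^ 2 * ζ₅ ^ 2
    let Sz4 : ℝ := ζ₁ ^ 4 + ζ₂ ^ 4 + ζ₃ ^ 4 + ζ₄ ^ 4 - ζ₅ ^ 4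
    1 / 2 * SA * Su + SAu ^ 2 - 3 * SA2u2 + (3 * Su4 - 3 / 2 * Su ^ 2)
      = 1 / 2 * Sy * Sz + Syz ^ 2 - 3 * Sy2z2 + (3 * Sz4 - 3 / 2 * Sz ^ 2) := by
  intro y₅ ζ₅ A₁ A₂ A₃ A₄ B₁ B₂ u₁ u₂ u₃ u₄ v₁ v₂ SA Su SAu SA2u2 Su4 Sy Sz Syz Sy2z2 Sz4
  obtain ⟨h1, h2⟩ := fDeletion_identities a c y₁ y₂ y₃ y₄ ζ₁ ζ₂ ζ₃ ζ₄
  simp only [SA, Su, SAu, SA2u2, Su4, Sy, Sz, Syz, Sy2z2, Sz4, A₁, A₂, A₃, A₄, B₁, B₂, u₁, u₂, u₃, u₄, v₁, v₂, y₅, ζ₅]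
  linear_combination h1 + h2 + (-(2 * a)) * hP2 + (-(2 * c)) * hP1 + (4 * c) * hP4

end Summit.HodgeConjecture.HodgeConjecture.WeilClassTestFDeletion
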